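import Summits.QuantumFields.YangMills.Theorems.BalabanUVNodesN15TorusPeriodisation
import HarnessLib

/-!
# Route «BalabanUVNodes» (K3⁷), node N15 = NE2, -a lane, PROGRAMME P file P-Ib: DESCENT OF THE BLOCK LETTERS AND OF BAŁABAN's LANDAU-GAUGE OPERATOR `Δ_a` AND ITS INVERSE `G`
# ALONG THE PERIODISATION `π : Tor (fine n M) → Tor (fine n M′)`, `M′ ∣ M`

Cell `pub-ymgap`, seat `pub-ymgap-dag-n15-a` (KNIT-BY-NAME, g20; D-0062; chair R424 venue; `bears_on: R4∕N15`); `--kind proof --supports stmt-QuantumFields-20544 --as helper`.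
Sequel of P-Ia `…N15TorusPeriodisation` (`torRed`, fibres, `pullS`∕`pullV`, descent of `Δ, ∂, ∂*, Σ∇*∇, Π₀, Δ⁻¹`, `rect_inv_comm`).

WHAT.  §5 two nested unit lattices `M′ ∣ M` and their fine lattices `nM′ ∣ nM` (`fine_dvd`): ★ `torRed_up`∕`torRed_bpt`∕`blockOf_torRed` (BLOCKS GO TO BLOCKS: `π(n·y + j) = n·π̃(y) + j`),
hence the descent of the block letters `QsOp` (1.20), `QsOpᴴ`, ★ `QvOp` (1.18), `QvOpᴴ`, `QvAdj`, then `Mop = Q′Δ⁻²Q′*`, `Cavg` (equal fibres), `Kmat`, `Minv = K⁻¹`, ★ `PcT` (1.26)∕(1.70), and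
★★ `DeltaA_mul_pullV` — `Δ_a^{M} π^* = π^* Δ_a^{M′}` for BAŁABAN's `Δ_a = Δ − ∂P∂* + aQ*Q` ([Balaban1984PropagatorsI] (1.69)∕(1.73)) INCLUDING ITS NONLOCAL LANDAU TERM — and
★★ `DeltaA_inv_mul_pullV` (`G^{M} π^* = π^* G^{M′}`, `G = Δ_a⁻¹` (1.71): the big-torus propagator of a periodic source is the periodic extension of the small-torus propagator), real forms.
§6 the pull-back of REAL 1-forms `pullVR n hM` (and of real scalars `pullSR`) with ★★★ `deltaOp_comp_pullVR`, ★★★ `gOp_comp_pullVR` for this lineage's `deltaOp M n a`, `gOp M n a` — the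
input of P-II (the lift of programme N's Neumann cube propagator from the doubled torus to the torus family of record).
HONEST FRAMING.  Finite-dimensional lattice algebra (rectangular 0∕1 intertwiners and `A·P = P·A′ ⟹ A⁻¹·P = P·A′⁻¹`); no estimate; `U ≡ 1` torus MODEL of [B5] §1; print's
«identify □̃³ with a torus, imposing periodicity conditions» ([Balaban1984PropagatorsII] p.238) is the DEVICE, nothing of (2.38)–(2.40)∕[B9] is asserted; N15 NOT discharged (object-bound;
NE2⁺ NOT PRINTED); counts UNMOVED (typed 28∕28 · discharged 5∕27); finite tori at fixed lattice spacing — NOT continuum ∕ ℝ⁴ ∕ OS ∕ mass gap ∕ Clay.  Plumbing defs are DATA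
(`pullVR`, `pullSR`); every theorem is [folklore] lattice algebra about printed objects.
-/

noncomputable section

open scoped BigOperators Matrix ComplexConjugate
open Finset

namespace Summit.QuantumFields.YangMills.BalabanUVNodes.N15.TwoGrid

open Literature.MathematicalPhysics.QuantumFieldTheory.Balaban1983to89
open Literature.MathematicalPhysics.QuantumFieldTheory.Balaban1983to89.B5Prop11Plancherel (Tor fine unitVec shiftM fdiff)
open Literature.MathematicalPhysics.QuantumFieldTheory.Balaban1983to89.B5Block118 (tstep up upHom iota bpt lineSum QsOp QvOp QsOp_mulVec QvOp_mulVec tstep_succ)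
open Literature.MathematicalPhysics.QuantumFieldTheory.Balaban1983to89.B5Action121 (shiftS sdiff sdiff_mulVec GradOp GradOp_mulVec LapS LapS_mulVec LapV)
open Literature.MathematicalPhysics.QuantumFieldTheory.Balaban1983to89.B5Prop11Lower (Lap)
open Literature.MathematicalPhysics.QuantumFieldTheory.Balaban1983to89.B5LaplaceInverse (LapSinv Pker)
open Literature.MathematicalPhysics.QuantumFieldTheory.Balaban1983to89.B5RealFields (IsReal reM)

variable {d : ℕ}

/-! ## §5 Descent through the block letters and through `Δ_a`, `G = Δ_a⁻¹` (unit lattices `M′ ∣ M`, fine lattices `nM′ ∣ nM`) -/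

section Blocks

open Literature.MathematicalPhysics.QuantumFieldTheory.Balaban1983to89.B5Substitution125 (Mop Cavg Kmat Minv Kmat_isUnit)
open Literature.MathematicalPhysics.QuantumFieldTheory.Balaban1983to89.B5Value126 (PcT)
open Literature.MathematicalPhysics.QuantumFieldTheory.Balaban1983to89.B5DeltaA169 (DeltaA QvAdj isUnit_DeltaA)
open Literature.MathematicalPhysics.QuantumFieldTheory.Balaban1983to89.B5RealFields (GR DeltaAR isReal_DeltaA)

variable (n : ℕ)

/-- `M′ ∣ M` gives `nM′ ∣ nM`: the fine lattices reduce along with the unit lattices. [folklore] -/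
theorem fine_dvd {M M' : Fin d → ℕ} (hM : ∀ μ, M' μ ∣ M μ) : ∀ μ, fine n M' μ ∣ fine n M μ := fun μ => mul_dvd_mul_left n (hM μ)

variable [NeZero n] {M M' : Fin d → ℕ} [∀ μ, NeZero (M μ)] [∀ μ, NeZero (M' μ)] (hM : ∀ μ, M' μ ∣ M μ)

omit [NeZero n] [∀ μ, NeZero (M μ)] [∀ μ, NeZero (M' μ)] in
/-- `π(n·y) = n·π̃(y)`: the fine reduction of a unit-lattice point read on the fine lattice is the unit-lattice reduction read on the fine lattice. [folklore] -/
theorem torRed_up (y : Tor M) : torRed (fine_dvd n hM) (up n M y) = up n M' (torRed hM y) := by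
  funext ν
  obtain ⟨z, hz⟩ := ZMod.intCast_surjective (y ν)
  have h1 : up n M y ν = (n : ZMod (fine n M ν)) * (z : ZMod (fine n M ν)) := by
    show upHom n M ν (y ν) = _; rw [← hz]; exact B5Block118.upHom_intCast n M ν z
  have h2 : torRed hM y ν = (z : ZMod (M' ν)) := by rw [torRed_apply, ← hz, map_intCast]
  have h3 : up n M' (torRed hM y) ν = (n : ZMod (fine n M' ν)) * (z : ZMod (fine n M' ν)) := by
    show upHom n M' ν (torRed hM y ν) = _; rw [h2]; exact B5Block118.upHom_intCast n M' ν z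
  rw [torRed_apply, h1, h3, map_mul, map_natCast, map_intCast]

omit [NeZero n] [∀ μ, NeZero (M μ)] [∀ μ, NeZero (M' μ)] in
/-- `π(j) = j` for the in-block offsets. [folklore] -/
theorem torRed_iota (j : Fin d → Fin n) : torRed (fine_dvd n hM) (iota n M j) = iota n M' j := by
  funext ν; simp only [torRed_apply, iota, map_natCast]

omit [NeZero n] [∀ μ, NeZero (M μ)] [∀ μ, NeZero (M' μ)] in
/-- ★ **BLOCKS GO TO BLOCKS**: `π(n·y + j) = n·π̃(y) + j`. [cite: Balaban1984PropagatorsI, (1.6) p.18] -/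
theorem torRed_bpt (y : Tor M) (j : Fin d → Fin n) : torRed (fine_dvd n hM) (bpt n M y j) = bpt n M' (torRed hM y) j := by
  rw [bpt, bpt, torRed_add, torRed_up n hM, torRed_iota n hM]

/-- `blockOf ∘ π = π̃ ∘ blockOf`. [cite: Balaban1984PropagatorsI, (1.6) p.18] -/
theorem blockOf_torRed (x : Tor (fine n M)) : B5Blocks16.blockOf n M' (torRed (fine_dvd n hM) x) = torRed hM (B5Blocks16.blockOf n M x) := by
  obtain ⟨⟨y, j⟩, rfl⟩ := (B5Blocks16.bpt_bijective n M).2 x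
  show B5Blocks16.blockOf n M' (torRed (fine_dvd n hM) (bpt n M y j)) = torRed hM (B5Blocks16.blockOf n M (bpt n M y j))
  rw [torRed_bpt n hM, B5Blocks16.blockOf_bpt, B5Blocks16.blockOf_bpt]

/-- `Q′_M π^* = π̃^* Q′_{M′}` for the scalar block average (1.20). [cite: Balaban1984PropagatorsI, (1.20) p.20] -/
theorem QsOp_mul_pullS : QsOp n M * pullS (fine_dvd n hM) = pullS hM * QsOp n M' := by
  refine matrix_eq_of_mulVec_eq fun f => funext fun y => ?_
  rw [← Matrix.mulVec_mulVec, ← Matrix.mulVec_mulVec, QsOp_mulVec, pullS_mulVec, QsOp_mulVec]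
  congr 1
  refine Finset.sum_congr rfl fun j _ => ?_
  rw [pullS_mulVec, torRed_bpt n hM]

/-- `Q′ᴴ_M π̃^* = π^* Q′ᴴ_{M′}`: the block-constant extension descends. [cite: Balaban1984PropagatorsI, (1.20) p.20] -/
theorem QsOp_conjTranspose_mul_pullS : (QsOp n M)ᴴ * pullS hM = pullS (fine_dvd n hM) * (QsOp n M')ᴴ := by
  refine matrix_eq_of_mulVec_eq fun ω => funext fun x => ?_
  rw [← Matrix.mulVec_mulVec, ← Matrix.mulVec_mulVec, B5Adjoint130.QsOp_adjoint_mulVec, pullS_mulVec, pullS_mulVec, B5Adjoint130.QsOp_adjoint_mulVec,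
    blockOf_torRed n hM]

/-- ★ `Q_M π^* = π̃^* Q_{M′}` FOR BAŁABAN's VECTOR AVERAGE (1.18): straight contours of `n` fine bonds go to straight contours. [cite: Balaban1984PropagatorsI, (1.18) p.20] -/
theorem QvOp_mul_pullV : QvOp n M * pullV (fine_dvd n hM) = pullV hM * QvOp n M' := by
  refine matrix_eq_of_mulVec_eq fun A => funext fun i => ?_
  obtain ⟨y, μ⟩ := i
  rw [← Matrix.mulVec_mulVec, ← Matrix.mulVec_mulVec, QvOp_mulVec, pullV_mulVec, QvOp_mulVec]
  congr 1
  refine Finset.sum_congr rfl fun j _ => ?_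
  simp only [lineSum, pullV_mulVec, torRed_add_tstep, torRed_bpt n hM]

/-- `Qᴴ_M π̃^* = π^* Qᴴ_{M′}`. [cite: Balaban1984PropagatorsI, (1.18) p.20] -/
theorem QvOp_conjTranspose_mul_pullV : (QvOp n M)ᴴ * pullV hM = pullV (fine_dvd n hM) * (QvOp n M')ᴴ := by
  refine matrix_eq_of_mulVec_eq fun B => funext fun i => ?_
  obtain ⟨x, κ⟩ := i
  rw [← Matrix.mulVec_mulVec, ← Matrix.mulVec_mulVec, B5Adjoint176.QvOp_adjoint_mulVec, pullV_mulVec, B5Adjoint176.QvOp_adjoint_mulVec]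
  congr 1
  refine Finset.sum_congr rfl fun t _ => ?_
  rw [pullV_mulVec, ← torRed_sub_tstep, blockOf_torRed n hM]

/-- `Q*_M π̃^* = π^* Q*_{M′}` for `Q* = n^d•Qᴴ`. [cite: Balaban1984PropagatorsI, (1.69) p.29] -/
theorem QvAdj_mul_pullV : QvAdj n M * pullV hM = pullV (fine_dvd n hM) * QvAdj n M' := by
  rw [QvAdj, QvAdj, Matrix.smul_mul, Matrix.mul_smul, QvOp_conjTranspose_mul_pullV]

variable (c : ℂ)

/-- `(Q′Δ⁻²Q′*)_M π̃^* = π̃^* (Q′Δ⁻²Q′*)_{M′}`. [cite: Balaban1984PropagatorsI, Sect. C p.22] -/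
theorem Mop_mul_pullS (hc : c ≠ 0) : Mop n M c * pullS hM = pullS hM * Mop n M' c := by
  simp only [Mop, Matrix.mul_assoc]
  rw [QsOp_conjTranspose_mul_pullS n hM, ← Matrix.mul_assoc (LapSinv _ c) (pullS _), LapSinv_mul_pullS _ c hc, Matrix.mul_assoc,
    ← Matrix.mul_assoc (LapSinv _ c) (pullS _), LapSinv_mul_pullS _ c hc, Matrix.mul_assoc, ← Matrix.mul_assoc (QsOp n M), QsOp_mul_pullS n hM, Matrix.mul_assoc]

/-- the averaging matrix descends: `C_M π̃^* = π̃^* C_{M′}` (equal fibres). [folklore] -/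
theorem Cavg_mul_pullS : Cavg M * pullS hM = pullS hM * Cavg M' := by
  refine matrix_eq_of_mulVec_eq fun f => funext fun x => ?_
  rw [← Matrix.mulVec_mulVec, ← Matrix.mulVec_mulVec, B5Substitution125.Cavg_mulVec, pullS_mulVec, B5Substitution125.Cavg_mulVec, sum_pullS_mulVec, ← mul_assoc,
    div_mul_eq_mul_div, one_mul, fibCard_div_card]

/-- `K_M π̃^* = π̃^* K_{M′}` for `K = Q′Δ⁻²Q′* + C`. [folklore] -/
theorem Kmat_mul_pullS (hc : c ≠ 0) : Kmat n M c * pullS hM = pullS hM * Kmat n M' c := by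
  rw [Kmat, Kmat, Matrix.add_mul, Matrix.mul_add, Mop_mul_pullS n hM c hc, Cavg_mul_pullS]

/-- `K⁻¹_M π̃^* = π̃^* K⁻¹_{M′}`. [folklore] -/
theorem Minv_mul_pullS (hc : c ≠ 0) : Minv n M c * pullS hM = pullS hM * Minv n M' c :=
  rect_inv_comm ((Matrix.isUnit_iff_isUnit_det _).mp (Kmat_isUnit n M c hc)) ((Matrix.isUnit_iff_isUnit_det _).mp (Kmat_isUnit n M' c hc))
    (Kmat_mul_pullS n hM c hc)

/-- ★ `P_M π^* = π^* P_{M′}` for the projection `P = Δ⁻¹Q′*(Q′Δ⁻²Q′*)⁻¹Q′Δ⁻¹` of (1.26)∕(1.70). [cite: Balaban1984PropagatorsI, (1.26) p.22, (1.70) p.30] -/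
theorem PcT_mul_pullS (hc : c ≠ 0) : PcT n M c * pullS (fine_dvd n hM) = pullS (fine_dvd n hM) * PcT n M' c := by
  show LapSinv (fine n M) c * (QsOp n M)ᴴ * Minv n M c * QsOp n M * LapSinv (fine n M) c * pullS (fine_dvd n hM)
      = pullS (fine_dvd n hM) * (LapSinv (fine n M') c * (QsOp n M')ᴴ * Minv n M' c * QsOp n M' * LapSinv (fine n M') c)
  simp only [Matrix.mul_assoc]
  rw [LapSinv_mul_pullS _ c hc, ← Matrix.mul_assoc (QsOp n M), QsOp_mul_pullS n hM, Matrix.mul_assoc, ← Matrix.mul_assoc (Minv n M c), Minv_mul_pullS n hM c hc,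
    Matrix.mul_assoc, ← Matrix.mul_assoc ((QsOp n M)ᴴ), QsOp_conjTranspose_mul_pullS n hM, Matrix.mul_assoc, ← Matrix.mul_assoc (LapSinv _ c),
    LapSinv_mul_pullS _ c hc, Matrix.mul_assoc]

variable (a : ℝ)

/-- ★★ **`Δ_a^{M} π^* = π^* Δ_a^{M′}`: BAŁABAN's LANDAU-GAUGE OPERATOR `Δ_a = Δ − ∂P∂* + aQ*Q` DESCENDS ALONG THE PERIODISATION** (every letter does). [cite: Balaban1984PropagatorsI, (1.69) p.29, (1.73) p.30; Balaban1984PropagatorsII, p.238] -/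
theorem DeltaA_mul_pullV : DeltaA n M a * pullV (fine_dvd n hM) = pullV (fine_dvd n hM) * DeltaA n M' a := by
  have hc : (n : ℂ) ≠ 0 := Nat.cast_ne_zero.mpr (NeZero.ne n)
  have t2 : GradOp (fine n M) (n : ℂ) * PcT n M (n : ℂ) * (GradOp (fine n M) (n : ℂ))ᴴ * pullV (fine_dvd n hM)
      = pullV (fine_dvd n hM) * (GradOp (fine n M') (n : ℂ) * PcT n M' (n : ℂ) * (GradOp (fine n M') (n : ℂ))ᴴ) := by
    rw [Matrix.mul_assoc, Matrix.mul_assoc, GradOp_conjTranspose_mul_pullV, ← Matrix.mul_assoc (PcT n M _), PcT_mul_pullS n hM _ hc, Matrix.mul_assoc,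
      ← Matrix.mul_assoc, ← Matrix.mul_assoc, GradOp_mul_pullS, Matrix.mul_assoc, Matrix.mul_assoc, Matrix.mul_assoc]
  have t3 : QvAdj n M * QvOp n M * pullV (fine_dvd n hM) = pullV (fine_dvd n hM) * (QvAdj n M' * QvOp n M') := by
    rw [Matrix.mul_assoc, QvOp_mul_pullV n hM, ← Matrix.mul_assoc, QvAdj_mul_pullV n hM, Matrix.mul_assoc]
  rw [DeltaA, DeltaA, B5Action121.Lap_eq_LapV, B5Action121.Lap_eq_LapV, Matrix.add_mul, Matrix.sub_mul, Matrix.mul_add, Matrix.mul_sub, Matrix.smul_mul,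
    Matrix.mul_smul, LapV_mul_pullV, t2, t3]

/-- ★★ `G^{M} π^* = π^* G^{M′}` for `G = Δ_a⁻¹` (`n ≥ 1`, `a > 0`): THE TORUS PROPAGATOR DESCENDS — the periodisation of the big-torus propagator is the small-torus propagator.
[cite: Balaban1984PropagatorsI, (1.71) p.30; Balaban1984PropagatorsII, p.238] -/
theorem DeltaA_inv_mul_pullV (hn : 1 ≤ n) (ha : 0 < a) : (DeltaA n M a)⁻¹ * pullV (fine_dvd n hM) = pullV (fine_dvd n hM) * (DeltaA n M' a)⁻¹ :=
  rect_inv_comm ((Matrix.isUnit_iff_isUnit_det _).mp (isUnit_DeltaA n hn M a ha)) ((Matrix.isUnit_iff_isUnit_det _).mp (isUnit_DeltaA n hn M' a ha))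
    (DeltaA_mul_pullV n hM a)

/-- the same for the REAL matrices `DeltaAR = re Δ_a`. [folklore] -/
theorem DeltaAR_mul_reM_pullV : DeltaAR n M a * reM (pullV (fine_dvd n hM)) = reM (pullV (fine_dvd n hM)) * DeltaAR n M' a := by
  rw [DeltaAR, DeltaAR, ← IsReal.reM_mul (isReal_DeltaA n M a) (isReal_pullV _), ← IsReal.reM_mul (isReal_pullV _) (isReal_DeltaA n M' a), DeltaA_mul_pullV n hM a]

/-- the same for `GR = re Δ_a⁻¹`. [folklore] -/
theorem GR_mul_reM_pullV (hn : 1 ≤ n) (ha : 0 < a) : GR n M a * reM (pullV (fine_dvd n hM)) = reM (pullV (fine_dvd n hM)) * GR n M' a := by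
  rw [GR, GR, ← IsReal.reM_mul (B5RealFields.isReal_DeltaA_inv n M a) (isReal_pullV _), ← IsReal.reM_mul (isReal_pullV _) (B5RealFields.isReal_DeltaA_inv n M' a),
    DeltaA_inv_mul_pullV n hM a hn ha]

end Blocks

/-! ## §6 The pull-back of real 1-forms; `Δ_a ∘ π^* = π^* ∘ Δ_a`, `G ∘ π^* = π^* ∘ G` for the operators of this lineage -/

section RealOps

open Literature.MathematicalPhysics.QuantumFieldTheory.Balaban1983to89.B5RealFields (GR DeltaAR)

variable (n : ℕ) [NeZero n] {M M' : Fin (d + 1) → ℕ} [∀ μ, NeZero (M μ)] [∀ μ, NeZero (M' μ)] (hM : ∀ μ, M' μ ∣ M μ)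

/-- **THE PULL-BACK OF REAL 1-FORMS** along the periodisation `π : Tor (fine n M) → Tor (fine n M′)`: `(π^*A)(x, μ) = A(πx, μ)`. [cite: Balaban1984PropagatorsII, p.238 («identify … with a torus … imposing periodicity conditions»)] -/
def pullVR : (Tor (fine n M') × Fin (d + 1) → ℝ) →ₗ[ℝ] (Tor (fine n M) × Fin (d + 1) → ℝ) := Matrix.mulVecLin (reM (pullV (fine_dvd n hM)))

/-- the pull-back of real scalar functions along a reduction `π : Tor N → Tor N′` (used on the unit lattices and on the fine lattices). [folklore] -/
def pullSR {N N' : Fin (d + 1) → ℕ} [∀ μ, NeZero (N' μ)] (hN : ∀ μ, N' μ ∣ N μ) : (Tor N' → ℝ) →ₗ[ℝ] (Tor N → ℝ) := Matrix.mulVecLin (reM (pullS hN))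

variable {n hM}

omit [∀ μ, NeZero (M μ)] in
/-- `(π^*A)(x, μ) = A(πx, μ)` on real 1-forms. [folklore] -/
theorem pullVR_apply (A : Tor (fine n M') × Fin (d + 1) → ℝ) (x : Tor (fine n M)) (μ : Fin (d + 1)) : pullVR n hM A (x, μ) = A (torRed (fine_dvd n hM) x, μ) := by
  have h := congrFun (IsReal.cplx_mulVec (isReal_pullV (fine_dvd n hM)) A) (x, μ)
  rw [B5RealFields.cplx_apply, pullV_mulVec] at h
  rw [pullVR, Matrix.mulVecLin_apply]
  exact Complex.ofReal_injective (by rw [h, B5RealFields.cplx_apply])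

/-- `(π^*f)(x) = f(πx)` on real functions. [folklore] -/
theorem pullSR_apply {N N' : Fin (d + 1) → ℕ} [∀ μ, NeZero (N' μ)] (hN : ∀ μ, N' μ ∣ N μ) (f : Tor N' → ℝ) (x : Tor N) : pullSR hN f x = f (torRed hN x) := by
  have h := congrFun (IsReal.cplx_mulVec (isReal_pullS hN) f) x
  rw [B5RealFields.cplx_apply, pullS_mulVec] at h
  rw [pullSR, Matrix.mulVecLin_apply]
  exact Complex.ofReal_injective (by rw [h, B5RealFields.cplx_apply])

omit [∀ μ, NeZero (M μ)] in
/-- `π^*A` as a composition: `π^*A = A ∘ (π × id)`. [folklore] -/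
theorem pullVR_eq_comp (A : Tor (fine n M') × Fin (d + 1) → ℝ) : pullVR n hM A = fun i => A (torRed (fine_dvd n hM) i.1, i.2) := by
  funext i; obtain ⟨x, μ⟩ := i; exact pullVR_apply A x μ

omit [∀ μ, NeZero (M μ)] in
/-- `π^*` is injective on 1-forms (π is onto). [folklore] -/
theorem pullVR_injective : Function.Injective (pullVR n hM) := by
  intro A B h
  funext j; obtain ⟨y, μ⟩ := j
  obtain ⟨x, rfl⟩ := torRed_surjective (fine_dvd n hM) y
  rw [← pullVR_apply (hM := hM) A x μ, ← pullVR_apply (hM := hM) B x μ, h]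

variable (n hM) (a : ℝ)

/-- ★★★ **`Δ_a ∘ π^* = π^* ∘ Δ_a` on real 1-forms** (`deltaOp M n a` on the big torus, `deltaOp M′ n a` on the small one). [cite: Balaban1984PropagatorsI, (1.69) p.29; Balaban1984PropagatorsII, p.238] -/
theorem deltaOp_comp_pullVR : deltaOp M n a ∘ₗ pullVR n hM = pullVR n hM ∘ₗ deltaOp M' n a := by
  rw [pullVR, deltaOp, deltaOp, ← Matrix.mulVecLin_mul, ← Matrix.mulVecLin_mul, DeltaAR_mul_reM_pullV n hM a]

/-- ★★★ **`G ∘ π^* = π^* ∘ G` on real 1-forms** for Bałaban's `U ≡ 1` Landau-gauge torus propagators `G = gOp M n a`, `gOp M′ n a` (`n ≥ 1`, `a > 0`): the propagator of the big torus applied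
to a periodic source is the periodic extension of the small-torus propagator. [cite: Balaban1984PropagatorsI, (1.71) p.30; Balaban1984PropagatorsII, p.238] -/
theorem gOp_comp_pullVR (hn : 1 ≤ n) (ha : 0 < a) : gOp M n a ∘ₗ pullVR n hM = pullVR n hM ∘ₗ gOp M' n a := by
  rw [pullVR, gOp, gOp, ← Matrix.mulVecLin_mul, ← Matrix.mulVecLin_mul, GR_mul_reM_pullV n hM a hn ha]

/-- pointwise form of the descent of `G`: `(G(π^*A))(x, μ) = (G′A)(πx, μ)`. [folklore] -/
theorem gOp_pullVR_apply (hn : 1 ≤ n) (ha : 0 < a) (A : Tor (fine n M') × Fin (d + 1) → ℝ) (x : Tor (fine n M)) (μ : Fin (d + 1)) :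
    gOp M n a (pullVR n hM A) (x, μ) = gOp M' n a A (torRed (fine_dvd n hM) x, μ) := by
  have h := LinearMap.congr_fun (gOp_comp_pullVR n hM a hn ha) A
  rw [LinearMap.comp_apply, LinearMap.comp_apply] at h
  rw [h, pullVR_apply]

/-- pointwise form of the descent of `Δ_a`. [folklore] -/
theorem deltaOp_pullVR_apply (A : Tor (fine n M') × Fin (d + 1) → ℝ) (x : Tor (fine n M)) (μ : Fin (d + 1)) :
    deltaOp M n a (pullVR n hM A) (x, μ) = deltaOp M' n a A (torRed (fine_dvd n hM) x, μ) := by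
  have h := LinearMap.congr_fun (deltaOp_comp_pullVR n hM a) A
  rw [LinearMap.comp_apply, LinearMap.comp_apply] at h
  rw [h, pullVR_apply]

end RealOps

end Summit.QuantumFields.YangMills.BalabanUVNodes.N15.TwoGrid

end
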